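import Summits.QuantumFields.GaugeBoot.Certificates.SparseReducedWindowE
import Summits.QuantumFields.GaugeBoot.Certificates.KZL2rpD4TabA
import HarnessLib

/-!
# Reduced problem family `KZL2rpD4`: sortedness check of the entry tables (gb_lean_emit_win 0.10)

HONEST FRAMING (cell `pub-gaugeboot`): certified bounds on lattice expectations at stated coupling,
gauge group, dimension and torus size; NOT a mass gap, NOT a continuum limit, NOT a string tension;
NOT Yang–Mills-summit-bearing (barriers `FixedCouplingUltralocality`, `PerturbativeInvisibility`).
Family `KZL2rpD4` (signature sha256 `981d7f3d6150831051c56aaad864b12ea5331c9f99b4a9ca7663ff81a1066429`): ONE β-independent kernel check for the EARLY-EXIT window route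
(`Certificates/SparseReducedWindowE.lean`): every stored combination of `EB` lists its terms `(v, c)` with strictly increasing `v`
(`sortedCheck`), so a window walk may stop at the first `v ≥ hi`. Nothing is claimed about lattice gauge theory here.
-/

namespace Summit.QuantumFields.GaugeBoot.Certificates.KZL2rpD4

noncomputable section

open Summit.QuantumFields.GaugeBoot.Certificates.Sparse

set_option maxHeartbeats 0 in
/-- Kernel check: the terms of every stored combination are sorted by variable (strictly increasing). -/
theorem sorted_chk : sortedCheck EB = true := by
  decide +kernel

end

end Summit.QuantumFields.GaugeBoot.Certificates.KZL2rpD4
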